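import Summits.Ventures.PercRepro.C025ProfileFourRuleE
import Summits.Ventures.PercRepro.C025ProfileFourReduce
/-!
# THE ROW (2,4) — `(Dem)` of rule E by construction, and the reduction of the row to `CapE` (night-3 g9)
NIGHT3-G9-TWO-FOUR-CERTIFICATE.md §6. The three families of `C025ProfileFourRuleE` are non-empty whenever rule E needs
them (`Gfam_nonempty`: `B ∪ F_B` spans, so `F_B` has a pair independent in `M／B`; `Lfam_nonempty`;
`Pfam_nonempty_of_defic_pos`: a positive deficit of a pair whose line has no third point forces a parallel pair of
`M／B` in `F_B`, completed to rank `4` by a third point). Hence **`dem_wE`**: every rank-`2` set receives at least its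
price, by the uniform spreading — and **`profileIneq_two_four_of_capE`**: the row `(2,4)` on EVERY finite matroid
follows from `CapE` (every rank-`4` set receives at most `1`) on simple matroids of rank `≥ 5`, through the double count
`profileIneq_of_cert` and the rule-free reduction `profileIneq_two_four_of_simple_five`.
-/
open scoped Matroid
namespace PercRepro
open Set Finset ThmH
section FourRuleEDem
variable {α : Type} [DecidableEq α] {M : Matroid α} [M.Finite]

/-- If adding `Z ⊆ E` to `X ⊆ E` raises the rank, some point of `Z` is outside `cl X`. -/
theorem exists_mem_notMem_closure_of_eRk_lt {X Z : Finset α} (hX : X ⊆ gr M)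
    (h : M.eRk (X : Set α) < M.eRk ((X ∪ Z : Finset α) : Set α)) :
    ∃ z ∈ Z, z ∉ M.closure (X : Set α) := by
  by_contra hcon
  push Not at hcon
  have hXE : (X : Set α) ⊆ M.E := by rw [← coe_gr]; exact_mod_cast hX
  have hsub : ((X ∪ Z : Finset α) : Set α) ⊆ M.closure (X : Set α) := by
    intro x hx
    rw [Finset.mem_coe, Finset.mem_union] at hx
    rcases hx with hx | hx
    · exact M.subset_closure _ hXE hx
    · exact hcon x hx
  have := M.eRk_mono hsub
  rw [M.eRk_closure_eq] at this
  exact absurd (lt_of_lt_of_le h this) (lt_irrefl _)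

/-- `B ∪ F_B` spans the whole matroid. -/
theorem eRank_le_eRk_union_Fs {B : Finset α} (hBg : B ⊆ gr M) :
    M.eRank ≤ M.eRk ((B ∪ Fs M B : Finset α) : Set α) := by
  rw [M.eRank_def, ← M.eRk_closure_eq ((B ∪ Fs M B : Finset α) : Set α)]
  apply M.eRk_mono
  intro x hx
  have hxg : x ∈ gr M := by rw [← Finset.mem_coe, coe_gr]; exact hx
  have hE : ((B ∪ Fs M B : Finset α) : Set α) ⊆ M.E := by
    rw [← coe_gr]; exact_mod_cast Finset.union_subset hBg (Fs_subset_gr B)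
  by_cases hcl : x ∈ clF M B
  · have h1 : x ∈ M.closure (B : Set α) := by rw [← coe_clF]; exact_mod_cast hcl
    exact M.closure_subset_closure (by rw [Finset.coe_union]; exact Set.subset_union_left) h1
  · exact M.subset_closure _ hE (by rw [Finset.mem_coe, Finset.mem_union]; exact Or.inr (mem_Fs.2 ⟨hxg, hcl⟩))

/-- **`G_B` is non-empty in rank `≥ 5`**: `F_B` contains a pair independent in `M／B`. -/
theorem Gfam_nonempty (hR : (5 : ℕ∞) ≤ M.eRank) {B : Finset α} (hB : B ∈ Profile.Rq M 2) :
    (Gfam M B).Nonempty := by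
  obtain ⟨hBg, hB2⟩ := Profile.mem_Rq.1 hB
  have h5 := (eRank_le_eRk_union_Fs hBg).trans' hR
  -- first point
  obtain ⟨y, hyF, hycl⟩ := exists_mem_notMem_closure_of_eRk_lt hBg (by
    rw [hB2]; exact lt_of_lt_of_le (by norm_num) h5)
  have hyE : y ∈ M.E := by rw [← coe_gr]; exact_mod_cast Fs_subset_gr B hyF
  have h3 : M.eRk ((insert y B : Finset α) : Set α) = 3 := by
    rw [Finset.coe_insert, Matroid.eRk_insert_eq_add_one ⟨hyE, hycl⟩, hB2]; rfl
  -- second point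
  have h5' : (5 : ℕ∞) ≤ M.eRk ((insert y B ∪ Fs M B : Finset α) : Set α) := by
    refine h5.trans (M.eRk_mono ?_)
    intro x hx
    rw [Finset.mem_coe, Finset.mem_union] at hx ⊢
    rcases hx with hx | hx
    · exact Or.inl (Finset.mem_insert_of_mem hx)
    · exact Or.inr hx
  obtain ⟨y', hy'F, hy'cl⟩ := exists_mem_notMem_closure_of_eRk_lt
    (Finset.insert_subset (Fs_subset_gr B hyF) hBg) (by rw [h3]; exact lt_of_lt_of_le (by norm_num) h5')
  have hy'E : y' ∈ M.E := by rw [← coe_gr]; exact_mod_cast Fs_subset_gr B hy'F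
  have h4 : M.eRk ((insert y' (insert y B) : Finset α) : Set α) = 4 := by
    rw [Finset.coe_insert, Matroid.eRk_insert_eq_add_one ⟨hy'E, hy'cl⟩, h3]; rfl
  have hne : y ≠ y' := by
    rintro rfl
    exact hy'cl (M.subset_closure _ (by rw [← coe_gr]; exact_mod_cast Finset.insert_subset (Fs_subset_gr B hyF) hBg)
      (by rw [Finset.coe_insert]; exact Set.mem_insert _ _))
  refine ⟨{y, y'}, mem_Gfam.2 ⟨?_, Finset.card_pair hne, ?_⟩⟩
  · intro x hx
    rw [Finset.mem_insert, Finset.mem_singleton] at hx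
    rcases hx with rfl | rfl
    exacts [hyF, hy'F]
  · rw [← h4]
    congr 1
    ext x
    simp only [Finset.coe_union, Finset.coe_insert, Finset.coe_singleton, Set.mem_union,
      Set.mem_insert_iff, Set.mem_singleton_iff]
    tauto

/-- `Ls_B` is non-empty when the line of `B` has a third point and `G_B` is non-empty. -/
theorem Lfam_nonempty {B : Finset α} (ht : 1 ≤ (clF M B \ B).card) (hG : (Gfam M B).Nonempty) :
    (Lfam M B).Nonempty := by
  obtain ⟨u, hu⟩ := Finset.card_pos.1 ht
  obtain ⟨Y, hY⟩ := hG
  exact ⟨insert u Y, mem_Lfam.2 ⟨u, hu, Y, hY, rfl⟩⟩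

/-- A pair of `F_B` has rank `3` or `4` over `B`; if not `4`, it is a parallel pair of `M／B`. -/
theorem eRk_union_pair_eq_three {B : Finset α} (hB2 : M.eRk (B : Set α) = 2)
    {y y' : α} (hy : y ∈ Fs M B)
    (h4 : M.eRk ((B ∪ {y, y'} : Finset α) : Set α) ≠ 4) : M.eRk ((B ∪ {y, y'} : Finset α) : Set α) = 3 := by
  have hyE : y ∈ M.E := by rw [← coe_gr]; exact_mod_cast Fs_subset_gr B hy
  have hycl : y ∉ M.closure (B : Set α) := by
    intro h; exact (mem_Fs.1 hy).2 (by rw [← Finset.mem_coe, coe_clF]; exact h)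
  have h3 : M.eRk ((insert y B : Finset α) : Set α) = 3 := by
    rw [Finset.coe_insert, Matroid.eRk_insert_eq_add_one ⟨hyE, hycl⟩, hB2]; rfl
  have hge : (3 : ℕ∞) ≤ M.eRk ((B ∪ {y, y'} : Finset α) : Set α) := by
    rw [← h3]
    apply M.eRk_mono
    intro x hx
    rw [Finset.mem_coe, Finset.mem_insert] at hx
    rw [Finset.mem_coe, Finset.mem_union, Finset.mem_insert, Finset.mem_singleton]
    tauto
  have hle : M.eRk ((B ∪ {y, y'} : Finset α) : Set α) ≤ 4 := by
    rw [Finset.coe_union]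
    refine (M.eRk_union_le_eRk_add_eRk _ _).trans ?_
    rw [hB2]
    have : M.eRk (({y, y'} : Finset α) : Set α) ≤ 2 := by
      refine (M.eRk_le_encard _).trans ?_
      rw [Set.encard_coe_eq_coe_finsetCard]
      exact_mod_cast Finset.card_le_two
    calc (2 : ℕ∞) + M.eRk (({y, y'} : Finset α) : Set α) ≤ 2 + 2 := add_le_add_right this 2
      _ = 4 := by norm_num
  have hfin : M.eRk ((B ∪ {y, y'} : Finset α) : Set α) ≠ ⊤ := (M.isRkFinite_set _).eRk_lt_top.ne
  obtain ⟨n, hn⟩ := ENat.ne_top_iff_exists.1 hfin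
  rw [← hn] at hge hle h4 ⊢
  have a : n ≤ 4 := by exact_mod_cast hle
  have b : 3 ≤ n := by exact_mod_cast hge
  have c : n ≠ 4 := fun h => h4 (by rw [h]; rfl)
  have : n = 3 := by omega
  rw [this]; rfl

/-- **`P_B` is non-empty when a pair `B` whose line has no third point has a positive deficit**: then
`|G_B| < C(p,2) ≤ C(|F_B|,2)`, so some pair of `F_B` is parallel in `M／B`, and a third point of `F_B` completes it
to rank `4` because `B ∪ F_B` spans. -/
theorem Pfam_nonempty_of_defic_pos (hR : (5 : ℕ∞) ≤ M.eRank) {B : Finset α} (hB : B ∈ Profile.Rq M 2)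
    (ht : (clF M B \ B).card = 0) (hd : 0 < defic M B) : (Pfam M B).Nonempty := by
  obtain ⟨hBg, hB2⟩ := Profile.mem_Rq.1 hB
  have hcl : clF M B = B := by
    have := Finset.card_eq_zero.1 ht
    rw [Finset.sdiff_eq_empty_iff_subset] at this
    exact le_antisymm this (subset_clF_self hBg)
  have hFs : Fs M B = gr M \ B := by unfold Fs; rw [hcl]
  have hp : 4 ≤ crk M B := by
    by_contra h
    push Not at h
    have h0 : Profile.price M 2 4 B = 0 := by rw [price_two_four_eq, if_neg (by omega)]
    unfold defic at hd
    rw [h0] at hd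
    have : (0 : ℚ) ≤ ((Gfam M B).card : ℚ) / 6 := by positivity
    rw [max_eq_left (by linarith)] at hd
    exact lt_irrefl _ hd
  have hprice : Profile.price M 2 4 B = (crk M B : ℚ) * ((crk M B : ℚ) - 1) / 12 := by
    rw [price_two_four_eq, if_pos hp]
  have hGlt : (Gfam M B).card < Nat.choose (crk M B) 2 := by
    unfold defic at hd
    rw [hprice] at hd
    have h1 : ((Gfam M B).card : ℚ) / 6 < (crk M B : ℚ) * ((crk M B : ℚ) - 1) / 12 := by
      by_contra h
      push Not at h
      rw [max_eq_left (by linarith)] at hd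
      exact lt_irrefl _ hd
    have h2 : ((Gfam M B).card : ℚ) < (Nat.choose (crk M B) 2 : ℚ) := by
      rw [Nat.cast_choose_two]; linarith
    exact_mod_cast h2
  have hpF : crk M B ≤ (Fs M B).card := by
    have h1 : M.eRk ((Fs M B : Finset α) : Set α) = (crk M B : ℕ∞) := by rw [hFs, eRk_gr_sdiff_eq_crk]
    have h2 := M.eRk_le_encard ((Fs M B : Finset α) : Set α)
    rw [h1, Set.encard_coe_eq_coe_finsetCard] at h2
    exact_mod_cast h2
  have hcard : Nat.choose (crk M B) 2 ≤ ((Fs M B).powersetCard 2).card := by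
    rw [Finset.card_powersetCard]; exact Nat.choose_le_choose 2 hpF
  obtain ⟨Y, hYp, hY4⟩ : ∃ Y ∈ (Fs M B).powersetCard 2, M.eRk ((B ∪ Y : Finset α) : Set α) ≠ 4 := by
    by_contra h
    push Not at h
    have : Gfam M B = (Fs M B).powersetCard 2 := by
      unfold Gfam; exact Finset.filter_true_of_mem h
    rw [this] at hGlt
    omega
  rw [Finset.mem_powersetCard] at hYp
  obtain ⟨y, y', hne, rfl⟩ := Finset.card_eq_two.1 hYp.2
  have hyF : y ∈ Fs M B := hYp.1 (Finset.mem_insert_self _ _)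
  have h3 := eRk_union_pair_eq_three hB2 hyF hY4
  -- a third point of `F_B` off the plane of `B ∪ {y, y'}`
  have hBYg : B ∪ {y, y'} ⊆ gr M :=
    Finset.union_subset hBg (hYp.1.trans (Fs_subset_gr B))
  have h5 : (5 : ℕ∞) ≤ M.eRk ((B ∪ {y, y'} ∪ Fs M B : Finset α) : Set α) := by
    refine ((eRank_le_eRk_union_Fs hBg).trans' hR).trans (M.eRk_mono ?_)
    intro x hx
    rw [Finset.mem_coe, Finset.mem_union] at hx ⊢
    rcases hx with hx | hx
    · exact Or.inl (Finset.mem_union_left _ hx)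
    · exact Or.inr hx
  obtain ⟨z, hzF, hzcl⟩ := exists_mem_notMem_closure_of_eRk_lt hBYg (by
    rw [h3]; exact lt_of_lt_of_le (by norm_num) h5)
  have hzE : z ∈ M.E := by rw [← coe_gr]; exact_mod_cast Fs_subset_gr B hzF
  have h4 : M.eRk ((insert z (B ∪ {y, y'}) : Finset α) : Set α) = 4 := by
    rw [Finset.coe_insert, Matroid.eRk_insert_eq_add_one ⟨hzE, hzcl⟩, h3]; rfl
  have hzY : z ∉ ({y, y'} : Finset α) := by
    intro hz
    exact hzcl (M.subset_closure _ (by rw [← coe_gr]; exact_mod_cast hBYg)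
      (by rw [Finset.mem_coe]; exact Finset.mem_union_right _ hz))
  refine ⟨insert z {y, y'}, mem_Pfam.2 ⟨?_, ?_, ?_, {y, y'}, Finset.subset_insert _ _, Finset.card_pair hne, h3⟩⟩
  · exact Finset.insert_subset hzF hYp.1
  · rw [Finset.card_insert_of_notMem hzY, Finset.card_pair hne]
  · rw [← h4]
    congr 1
    ext x
    simp only [Finset.coe_union, Finset.coe_insert, Finset.coe_singleton, Set.mem_union,
      Set.mem_insert_iff, Set.mem_singleton_iff]
    tauto

/-- The sets of `G_B ∪ P_B` are disjoint from `B` and give rank-`4` supersets. -/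
theorem family_G_or_P {B : Finset α} (hBg : B ⊆ gr M) :
    ∀ Z ∈ Gfam M B ∪ Pfam M B, Disjoint B Z ∧ B ∪ Z ∈ Shadow.levelSet M 4 := by
  intro Z hZ
  rw [Finset.mem_union] at hZ
  rcases hZ with hZ | hZ
  · exact disjoint_and_level_of_mem_Gfam hBg hZ
  · exact disjoint_and_level_of_mem_Pfam hBg hZ

/-- The sets of `G_B ∪ Ls_B` are disjoint from `B` and give rank-`4` supersets. -/
theorem family_G_or_L {B : Finset α} (hBg : B ⊆ gr M) :
    ∀ Z ∈ Gfam M B ∪ Lfam M B, Disjoint B Z ∧ B ∪ Z ∈ Shadow.levelSet M 4 := by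
  intro Z hZ
  rw [Finset.mem_union] at hZ
  rcases hZ with hZ | hZ
  · exact disjoint_and_level_of_mem_Gfam hBg hZ
  · exact disjoint_and_level_of_mem_Lfam hBg hZ

omit [DecidableEq α] in
/-- `|fam| · (d / |fam|) = d` for a non-empty family. -/
theorem card_mul_div_card {fam : Finset (Finset α)} (h : fam.Nonempty) (d : ℚ) :
    (fam.card : ℚ) * (d / (fam.card : ℚ)) = d := by
  have hc : (fam.card : ℚ) ≠ 0 := by exact_mod_cast (Finset.card_pos.2 h).ne'
  field_simp

/-- **`(Dem)` for rule E, by construction**: every rank-`2` set receives at least its price from the rank-`4` sets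
containing it (rank `≥ 5`). -/
theorem dem_wE (hR : (5 : ℕ∞) ≤ M.eRank) {B : Finset α} (hB : B ∈ Profile.Rq M 2) :
    Profile.price M 2 4 B ≤ ∑ S ∈ (Shadow.levelSet M 4).filter (fun S => B ⊆ S), wE M B S := by
  obtain ⟨hBg, _⟩ := Profile.mem_Rq.1 hB
  have hG := Gfam_nonempty hR hB
  by_cases hp : crk M B < 4
  · rw [price_two_four_eq, if_neg (by omega)]
    exact Finset.sum_nonneg (fun S _ => wE_nonneg B S)
  push Not at hp
  have hdef : Profile.price M 2 4 B - ((Gfam M B).card : ℚ) / 6 ≤ defic M B := le_max_right _ _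
  by_cases hc : B.card = 2
  · by_cases ht : 1 ≤ (clF M B \ B).card
    · -- the deficit goes to `Ls_B`
      refine le_trans ?_ (sum_levelSet_ge_sum_family (wE M B) (wE_nonneg B) (Gfam M B ∪ Lfam M B)
        (family_G_or_L hBg))
      have hval : ∀ Z ∈ Gfam M B ∪ Lfam M B, wE M B (B ∪ Z) =
          (if Z ∈ Gfam M B then (1 : ℚ) / 6 else 0) +
          (if Z ∈ Lfam M B then defic M B / ((Lfam M B).card : ℚ) else 0) := by
        intro Z hZ
        unfold wE
        rw [union_sdiff_self_eq (family_G_or_L hBg Z hZ).1, if_neg (not_lt.2 hp), if_pos hc, if_pos ht]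
      rw [Finset.sum_congr rfl hval, Finset.sum_add_distrib, Finset.sum_ite_mem, Finset.sum_ite_mem,
        Finset.inter_eq_right.2 Finset.subset_union_left, Finset.inter_eq_right.2 Finset.subset_union_right,
        Finset.sum_const, Finset.sum_const, nsmul_eq_mul, nsmul_eq_mul,
        card_mul_div_card (Lfam_nonempty ht hG)]
      linarith
    · -- the deficit goes to `P_B`
      have ht0 : (clF M B \ B).card = 0 := by omega
      refine le_trans ?_ (sum_levelSet_ge_sum_family (wE M B) (wE_nonneg B) (Gfam M B ∪ Pfam M B)
        (family_G_or_P hBg))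
      have hval : ∀ Z ∈ Gfam M B ∪ Pfam M B, wE M B (B ∪ Z) =
          (if Z ∈ Gfam M B then (1 : ℚ) / 6 else 0) +
          (if Z ∈ Pfam M B then defic M B / ((Pfam M B).card : ℚ) else 0) := by
        intro Z hZ
        unfold wE
        rw [union_sdiff_self_eq (family_G_or_P hBg Z hZ).1, if_neg (not_lt.2 hp), if_pos hc, if_neg ht]
      rw [Finset.sum_congr rfl hval, Finset.sum_add_distrib, Finset.sum_ite_mem, Finset.sum_ite_mem,
        Finset.inter_eq_right.2 Finset.subset_union_left, Finset.inter_eq_right.2 Finset.subset_union_right,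
        Finset.sum_const, Finset.sum_const, nsmul_eq_mul, nsmul_eq_mul]
      have hP : ((Pfam M B).card : ℚ) * (defic M B / ((Pfam M B).card : ℚ)) = defic M B := by
        by_cases hPe : (Pfam M B).Nonempty
        · exact card_mul_div_card hPe _
        · have hd0 : defic M B = 0 := by
            by_contra hne
            exact hPe (Pfam_nonempty_of_defic_pos hR hB ht0 (lt_of_le_of_ne (defic_nonneg B) (Ne.symm hne)))
          rw [hd0, zero_div, mul_zero]
      rw [hP]
      linarith
  · -- fat `B`: the price is spread over `G_B ∪ P_B`
    refine le_trans ?_ (sum_levelSet_ge_sum_family (wE M B) (wE_nonneg B) (Gfam M B ∪ Pfam M B)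
      (family_G_or_P hBg))
    have hval : ∀ Z ∈ Gfam M B ∪ Pfam M B, wE M B (B ∪ Z) =
        Profile.price M 2 4 B / (((Gfam M B ∪ Pfam M B).card : ℚ)) := by
      intro Z hZ
      unfold wE
      rw [union_sdiff_self_eq (family_G_or_P hBg Z hZ).1, if_neg (not_lt.2 hp), if_neg hc, if_pos hZ]
    rw [Finset.sum_congr rfl hval, Finset.sum_const, nsmul_eq_mul,
      card_mul_div_card (hG.mono Finset.subset_union_left)]

variable (M) in
/-- `(Cap)` for rule E on `M`: every rank-`4` set receives at most `1`. -/
def CapE : Prop :=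
  ∀ S ∈ Shadow.levelSet M 4, ∑ B ∈ (Profile.Rq M 2).filter (fun B => B ⊆ S), wE M B S ≤ 1

/-- **THE ROW `(2,4)` FOR EVERY FINITE MATROID, MODULO `(Cap)` OF RULE E ON SIMPLE MATROIDS OF RANK `≥ 5`**
(`(Dem)` is `dem_wE`). -/
theorem profileIneq_two_four_of_capE
    (hcap : ∀ (N : Matroid α) [N.Finite], (∀ T ⊆ N.E, T.encard ≤ 2 → N.Indep T) → (5 : ℕ∞) ≤ N.eRank → CapE N)
    (M : Matroid α) [M.Finite] : Profile.ProfileIneq M 2 4 :=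
  profileIneq_two_four_of_simple_five
    (fun N _ hs hR => profileIneq_of_cert (M := N) 2 4 (wE N) (hcap N hs hR) (fun _ hB => dem_wE hR hB)) M

end FourRuleEDem
end PercRepro
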